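import Literature.AlgebraicGeometry.DuqueFrancoVillaflor2023.FakeLinearCycleQuadraticForm
import Mathlib.LinearAlgebra.Matrix.SchurComplement
import HarnessLib

/-!
# The transition determinant of a linear cycle of the Fermat variety IS its cycle polynomial:
# `det Jac(f₁, g₁, …, f_{n/2+1}, g_{n/2+1}) = d^{n/2+1}·(∏ c_j)·∏_j Σ_l c_j^l x_{2j}^{d−2−l} x_{2j+1}^l`
# (Villaflor Loyola, manuscripta math. 167 (2022), Corollary 4, eq. (cycllinfer) and its proof)

Certified instances and evidence bearing on the general Hodge conjecture; no claim.

R. Villaflor Loyola, *Periods of complete intersection algebraic cycles*, manuscripta math. 167 (2022) 765–792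
= arXiv:1812.03964 [Villaflor2022PeriodsCI] (held text `paper:arxiv-1812.03964`, pp. 3, 13–14). **Theorem 1**
(p. 3): for `X = {F = 0} ⊂ ℙ^{n+1}` smooth of even dimension `n` and a complete intersection
`Z = {f_1 = ⋯ = f_{n/2+1} = 0} ⊂ X`, "Write `F = f_1g_1 + ⋯ + f_{n/2+1}g_{n/2+1}`, and define
`H = (h_0, …, h_{n+1}) := (f_1, g_1, …, f_{n/2+1}, g_{n/2+1})`. Then
`[Z] = deg(Z)/deg(X)·θ^{n/2} − ((n/2)!/deg(X))·res(det(Jac(H))Ω/F^{n/2+1})^{n/2,n/2}`", i.e. the primitive class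
of `Z` is represented in the Jacobian ring by the TRANSITION DETERMINANT `P_Z := det(Jac(H)) = det(∂h_i/∂x_j)`.
**Corollary 4** (pp. 13–14), verbatim: "Let `X = {x_0^d + ⋯ + x_{n+1}^d = 0}` be the Fermat variety. For
`α_0, α_2, …, α_n ∈ {1, 3, …, 2d−1}` consider `ℙ^{n/2}_α := {x_0 − ζ_{2d}^{α_0}x_1 = ⋯ = x_n − ζ_{2d}^{α_n}x_{n+1} = 0}`,
and `δ := ℙ^{n/2}_α`. Its associated polynomial is

  (cycllinfer) `P_δ = d^{n/2+1} ζ_{2d}^{α_0+α_2+⋯+α_n} ∏_{j=1}^{n/2+1} ( Σ_{l=0}^{d−2} x_{2j−2}^{d−2−l} ζ_{2d}^{α_{2j−2} l} x_{2j−1}^l )`.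

[…] *Proof.* Computing the Jacobian matrix of `H` as in Theorem 2, we see it is diagonal by `2×2` blocks, and
each block has determinant `d(ζ_{2d}^{α_{2j−2}} x_{2j−2}^{d−1} + x_{2j−1}^{d−1})/(x_{2j−2} − ζ_{2d}^{α_{2j−2}} x_{2j−1})`,
and so (cycllinfer) follows."  Here `f_j = x_{2j−2} − ζ^{α}x_{2j−1}` and `g_j = (x_{2j−2}^d + x_{2j−1}^d)/f_j
= Σ_{l<d} ζ^{α(d−1−l)} x_{2j−2}^{l} x_{2j−1}^{d−1−l}` (`ζ^{αd} = −1`).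

H. Movasati, R. Villaflor Loyola, *Periods of linear algebraic cycles*, Pure Appl. Math. Q. 14 (2018)
= arXiv:1705.00084 [MovasatiVillaflor2018], **Theorem 1**: for the cycle `ℙ^{n/2}_{a,b}` attached to a PAIRING `b`
(a permutation of `{0, …, n+1}`) the period carries the factor `sign(b)` — in the language of Theorem 1 above this
is the sign by which `det(Jac(H))` changes when the columns (variables) are matched to the rows (equations) through
another bijection ([Villaflor2022PeriodsCI] Cor. 5 "([MV])" re-derives MV18's Theorem 1 from Theorem 2).

## What this file PROVES (0 definitions, 0 named facts, 0 sorry), over any field `K`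

Vocabulary of the tree file `HodgeTheory/FermatLinearCycleGorensteinIdeal.lean` ([DuqueFrancoVillaflor2025Join]
Rem. 7.1): variables indexed by `τ ⊕ τ` (`Sum.inl j ↔ x_{2j}`, `Sum.inr j ↔ x_{2j+1}`, `#τ = n/2+1` pairs),
twists `c : τ → K` (Villaflor's `ζ_{2d}^{α_{2j}}`; a genuine linear cycle of the Fermat variety of degree `d` when
`c_j^d = −1`), `fermatLinearCycleFactor c e j = Σ_{l<e} x_{2j}^l (c_j x_{2j+1})^{e−1−l}` and
`fermatLinearCyclePolynomial c e = ∏_j fermatLinearCycleFactor c e j` (`e = d − 1`: Cor. 4's product `∏_j(Σ_l …)`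
is `fermatLinearCyclePolynomial c (d−1)` with `c_j = ζ^{α_{2j}}`, after `l ↦ d−2−l`). Villaflor's presentation
`H = (f, g)` is the family `Sum.elim u g : τ ⊕ τ → K[x]` with the LINEAR FORMS `u_j = x_{2j} − c_j x_{2j+1}` and the
COFACTORS `g_j = fermatLinearCycleFactor c d j` (exponent `d`, so that `u_j g_j = x_{2j}^d − c_j^d x_{2j+1}^d`),
and `Jac(H)` is the matrix `(∂H_p/∂x_q)_{p,q ∈ τ ⊕ τ}` (rows `u_j ↔ inl j`, `g_j ↔ inr j`; this is Villaflor's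
ordering `(f_1, g_1, f_2, g_2, …)` against `(x_0, x_1, x_2, x_3, …)`, so `det` below is his `det(Jac(H))`).

* `linearForm_mul_fermatLinearCycleFactor`, `sum_linearForm_mul_fermatLinearCycleFactor`: `u_j·g_j =
  x_{2j}^d − c_j^d x_{2j+1}^d`, hence `Σ_j u_j g_j = Σ_i x_i^d = F` when all `c_j^d = −1` ("Write `F = Σ f_j g_j`");
  `pderiv_sum_X_pow`, `span_pderiv_sum_X_pow`: `∂F/∂x_i = d·x_i^{d−1}`, so `J^F = (x_i^{d−1})` when `d ≠ 0` in `K`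
  (the ideal the tree files call `J`).
* `jacobian_eq_fromBlocks`: "the Jacobian matrix of `H` is diagonal by `2×2` blocks": in the row order `(u | g)` and
  column order `(x_{even} | x_{odd})` it is the block matrix `[[1, diag(−c_j)], [diag(∂g_j/∂x_{2j}), diag(∂g_j/∂x_{2j+1})]]`;
  `det_jacobian_eq_prod`: `det Jac(H) = ∏_j (∂g_j/∂x_{2j+1} + c_j ∂g_j/∂x_{2j})` (the `2×2` block determinants).
* `pderiv_inr_add_C_mul_pderiv_inl` — the block value: `∂g_j/∂x_{2j+1} + c_j ∂g_j/∂x_{2j} = d·c_j·Σ_{l<d−1}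
  x_{2j}^l (c_j x_{2j+1})^{d−2−l}` ("each block has determinant `d(ζ^α x^{d−1} + y^{d−1})/(x − ζ^α y)`"; proof here:
  the derivation `∂_y + c∂_x` kills `x − cy`, so applying it to `(x − cy)·g = x^d − c^d y^d` and cancelling `x − cy`
  gives the value — `K[x]` is a domain).
* **`det_jacobian_eq`** — eq. (cycllinfer): `det Jac(H) = C(d^{#τ}·∏_j c_j) · fermatLinearCyclePolynomial c (d−1)`
  (`d ≥ 1`; Villaflor: `d^{n/2+1} ζ^{Σα} ∏_j(…)`).
* Consequences at the Fermat point, for `d ≥ 2`, `d ≠ 0` in `K`, all `c_j ≠ 0` (tree `span_X_pow_colon_C_mul_…`,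
  `fermatLinearCyclePolynomial_not_mem`): `det_jacobian_not_mem` (`det Jac(H) ∉ J = (x_i^{d−1})`) and
  **`span_X_pow_colon_det_jacobian`**: `(J : det Jac(H)) = ⟨x_{2j} − c_j x_{2j+1}, x_i^{d−1}⟩ = fermatLinearCycleIdeal c (d−1)`
  — [DuqueFrancoVillaflor2025Join] eq. (eqAGfakelcFermat) for the transition determinant itself, with the EXACT constant
  `d^{n/2+1}∏c_j` relating Villaflor's `P_δ = det Jac(H)` to the normalised product `∏_j P_{λ_j}` of Rem. 7.1
  (the two differ by a non-zero constant, not merely modulo `J^F`).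
* `det_jacobian_rename` (MV18's `sign(b)`): for a POSITION map `ρ : τ ⊕ τ ≃ σ` (the cycle
  `{x_{ρ(inl j)} = c_j x_{ρ(inr j)}}` in variables `σ`, equations `rename ρ (H_p)`) and ANY matching `e : τ ⊕ τ ≃ σ` of
  equations with variables, `det (∂(rename ρ H_p)/∂x_{e(q)})_{p,q} = sign(ρ⁻¹∘e) · rename ρ (C(d^{#τ}∏c_j)·P_c)`;
  `det_jacobian_rename_self`: `= rename ρ (…)` for `e = ρ`.

NOT formalised (transcendental): Theorem 1 / Theorem 2 themselves (residues, periods, `[Z] ↔ det Jac(H)`); only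
the polynomial identity (cycllinfer) and its ideal-theoretic consequences are proved. The cell pub-hlocus uses
(cycllinfer) as the 'cycle polynomial' rule of its engine B and, through the coefficients of `P_c`, as the cycle
term of [MovasatiVillaflor2018] Thm. 1 in its engine A (record og81/MU0-SURFACES-ALLD-g31.md §8, THEOREM D (1)).
-/

noncomputable section

open MvPolynomial Matrix Literature.AlgebraicGeometry.HodgeTheory
  Literature.AlgebraicGeometry.DuqueFrancoVillaflor2023

namespace Literature.AlgebraicGeometry.Villaflor2022

variable {K : Type*} [Field K] {τ : Type*} (c : τ → K) (d : ℕ)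

/-! ## The presentation `F = Σ_j f_j g_j` along the linear forms of the cycle -/

/-- `f_j · g_j = x_{2j}^d − c_j^d·x_{2j+1}^d` for `f_j = x_{2j} − c_j x_{2j+1}`, `g_j = Σ_{l<d} x_{2j}^l (c_j x_{2j+1})^{d−1−l}`.
[cite: Villaflor2022PeriodsCI, Corollary 4 (proof)] [cite: DuqueFrancoVillaflor2025Join, Remark 7.1] -/
theorem linearForm_mul_fermatLinearCycleFactor (j : τ) :
    ((X (Sum.inl j) : MvPolynomial (τ ⊕ τ) K) - C (c j) * X (Sum.inr j)) * fermatLinearCycleFactor c d j =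
      X (Sum.inl j) ^ d - C (c j ^ d) * X (Sum.inr j) ^ d := by
  rw [X_sub_C_mul_X_mul_fermatLinearCycleFactor, mul_pow, map_pow]

/-- "Write `F = f_1g_1 + ⋯ + f_{n/2+1}g_{n/2+1}`": for a genuine linear cycle (`c_j^d = −1` for all `j`) the
presentation recovers the Fermat polynomial, `Σ_j f_j g_j = Σ_{i ∈ τ ⊕ τ} x_i^d`.
[cite: Villaflor2022PeriodsCI, Theorem 1, Corollary 4] -/
theorem sum_linearForm_mul_fermatLinearCycleFactor [Fintype τ] (hc : ∀ j, c j ^ d = -1) :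
    ∑ j, ((X (Sum.inl j) : MvPolynomial (τ ⊕ τ) K) - C (c j) * X (Sum.inr j)) * fermatLinearCycleFactor c d j =
      ∑ i : τ ⊕ τ, (X i : MvPolynomial (τ ⊕ τ) K) ^ d := by
  simp_rw [linearForm_mul_fermatLinearCycleFactor, hc, map_neg, map_one, neg_mul, one_mul, sub_neg_eq_add]
  rw [Fintype.sum_sum_type, Finset.sum_add_distrib]

/-- `∂(Σ_q x_q^d)/∂x_i = d·x_i^{d−1}`. [cite: Villaflor2022PeriodsCI, Theorem 2 (the Jacobian ideal `J^F`)] -/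
theorem pderiv_sum_X_pow [Fintype τ] [DecidableEq τ] (i : τ ⊕ τ) :
    pderiv i (∑ q : τ ⊕ τ, (X q : MvPolynomial (τ ⊕ τ) K) ^ d) = C (d : K) * X i ^ (d - 1) := by
  rw [map_sum, Finset.sum_eq_single i, pderiv_pow, pderiv_X_self, mul_one, map_natCast]
  · intro q _ hq
    rw [pderiv_pow, pderiv_X_of_ne hq, mul_zero]
  · intro h
    exact absurd (Finset.mem_univ i) h

/-- The Jacobian ideal of the Fermat polynomial in the paired variables is `(x_i^{d−1} : i ∈ τ ⊕ τ)` — the ideal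
`J` of the tree files — as soon as `d ≠ 0` in `K`. [cite: Villaflor2022PeriodsCI, Theorem 2 (the Jacobian ideal `J^F`), Corollary 4 (proof: "mod ⟨x_0^{d−1}, …, x_{n+1}^{d−1}⟩")] -/
theorem span_pderiv_sum_X_pow [Fintype τ] [DecidableEq τ] (hdK : (d : K) ≠ 0) :
    Ideal.span (Set.range fun i : τ ⊕ τ => pderiv i (∑ q : τ ⊕ τ, (X q : MvPolynomial (τ ⊕ τ) K) ^ d)) =
      Ideal.span (Set.range fun i : τ ⊕ τ => (X i : MvPolynomial (τ ⊕ τ) K) ^ (d - 1)) := by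
  simp_rw [pderiv_sum_X_pow]
  apply le_antisymm
  · rw [Ideal.span_le]
    rintro _ ⟨i, rfl⟩
    exact Ideal.mul_mem_left _ _ (Ideal.subset_span ⟨i, rfl⟩)
  · rw [Ideal.span_le]
    rintro _ ⟨i, rfl⟩
    have h : (X i : MvPolynomial (τ ⊕ τ) K) ^ (d - 1) = C (d : K)⁻¹ * (C (d : K) * X i ^ (d - 1)) := by
      rw [← mul_assoc, ← map_mul, inv_mul_cancel₀ hdK, map_one, one_mul]
    change (X i : MvPolynomial (τ ⊕ τ) K) ^ (d - 1) ∈ _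
    rw [h]
    exact Ideal.mul_mem_left _ _ (Ideal.subset_span ⟨i, rfl⟩)

/-! ## Partial derivatives of the linear forms -/

/-- `∂f_j/∂x_{2j} = 1`. [cite: Villaflor2022PeriodsCI, Corollary 4 (proof)] -/
theorem pderiv_inl_linearForm [DecidableEq τ] (j : τ) :
    pderiv (Sum.inl j) ((X (Sum.inl j) : MvPolynomial (τ ⊕ τ) K) - C (c j) * X (Sum.inr j)) = 1 := by
  rw [map_sub, pderiv_C_mul, pderiv_X_self, pderiv_X_of_ne (Sum.inr_ne_inl), mul_zero, sub_zero]

/-- `∂f_j/∂x_{2j+1} = −c_j`. [cite: Villaflor2022PeriodsCI, Corollary 4 (proof)] -/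
theorem pderiv_inr_linearForm [DecidableEq τ] (j : τ) :
    pderiv (Sum.inr j) ((X (Sum.inl j) : MvPolynomial (τ ⊕ τ) K) - C (c j) * X (Sum.inr j)) = -C (c j) := by
  rw [map_sub, pderiv_C_mul, pderiv_X_self, pderiv_X_of_ne (Sum.inl_ne_inr), mul_one, zero_sub]

/-- `∂f_j/∂x_q = 0` for the variables `q` outside the pair `j`. [cite: Villaflor2022PeriodsCI, Corollary 4 (proof)] -/
theorem pderiv_linearForm_of_ne [DecidableEq τ] (j : τ) (q : τ ⊕ τ) (h1 : q ≠ Sum.inl j) (h2 : q ≠ Sum.inr j) :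
    pderiv q ((X (Sum.inl j) : MvPolynomial (τ ⊕ τ) K) - C (c j) * X (Sum.inr j)) = 0 := by
  rw [map_sub, pderiv_C_mul, pderiv_X_of_ne h1.symm, pderiv_X_of_ne h2.symm, mul_zero, sub_zero]

/-- The linear form `f_j = x_{2j} − c_j x_{2j+1}` is not the zero polynomial. [folklore] -/
private theorem linearForm_ne_zero [DecidableEq τ] (j : τ) :
    ((X (Sum.inl j) : MvPolynomial (τ ⊕ τ) K) - C (c j) * X (Sum.inr j)) ≠ 0 := by
  intro h
  have h' := congr_arg (MvPolynomial.eval (Pi.single (Sum.inl j) (1 : K))) h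
  rw [map_sub, map_mul, eval_C, eval_X, eval_X, Pi.single_eq_same, Pi.single_eq_of_ne Sum.inr_ne_inl,
    mul_zero, sub_zero, map_zero] at h'
  exact one_ne_zero h'

/-! ## "The Jacobian matrix of `H` is diagonal by `2×2` blocks" -/

/-- The Jacobian matrix `(∂H_p/∂x_q)` of `H = (f | g)` in the row order `(f_j | g_j)` and the column order
`(x_{2j} | x_{2j+1})` is the block matrix `[[1, diag(−c_j)], [diag(∂g_j/∂x_{2j}), diag(∂g_j/∂x_{2j+1})]]` — all four
blocks diagonal: "diagonal by `2×2` blocks". [cite: Villaflor2022PeriodsCI, Corollary 4 (proof)] -/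
theorem jacobian_eq_fromBlocks [Fintype τ] [DecidableEq τ] :
    (Matrix.of fun p q : τ ⊕ τ => pderiv q (Sum.elim
        (fun j => (X (Sum.inl j) : MvPolynomial (τ ⊕ τ) K) - C (c j) * X (Sum.inr j))
        (fermatLinearCycleFactor c d) p)) =
      Matrix.fromBlocks 1 (Matrix.diagonal fun j => -C (c j))
        (Matrix.diagonal fun j => pderiv (Sum.inl j) (fermatLinearCycleFactor c d j))
        (Matrix.diagonal fun j => pderiv (Sum.inr j) (fermatLinearCycleFactor c d j)) := by
  ext p q
  rcases p with j | j <;> rcases q with j' | j'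
  · rw [Matrix.of_apply, Sum.elim_inl, Matrix.fromBlocks_apply₁₁, Matrix.one_apply]
    by_cases h : j = j'
    · subst h
      rw [if_pos rfl, pderiv_inl_linearForm]
    · rw [if_neg h, pderiv_linearForm_of_ne c j _ (fun h' => h (Sum.inl_injective h').symm) Sum.inl_ne_inr]
  · rw [Matrix.of_apply, Sum.elim_inl, Matrix.fromBlocks_apply₁₂, Matrix.diagonal_apply]
    by_cases h : j = j'
    · subst h
      rw [if_pos rfl, pderiv_inr_linearForm]
    · rw [if_neg h, pderiv_linearForm_of_ne c j _ Sum.inr_ne_inl (fun h' => h (Sum.inr_injective h').symm)]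
  · rw [Matrix.of_apply, Sum.elim_inr, Matrix.fromBlocks_apply₂₁, Matrix.diagonal_apply]
    by_cases h : j = j'
    · subst h
      rw [if_pos rfl]
    · rw [if_neg h, pderiv_fermatLinearCycleFactor_eq_zero c d j _
        (fun h' => h (Sum.inl_injective h').symm) Sum.inl_ne_inr]
  · rw [Matrix.of_apply, Sum.elim_inr, Matrix.fromBlocks_apply₂₂, Matrix.diagonal_apply]
    by_cases h : j = j'
    · subst h
      rw [if_pos rfl]
    · rw [if_neg h, pderiv_fermatLinearCycleFactor_eq_zero c d j _ Sum.inr_ne_inl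
        (fun h' => h (Sum.inr_injective h').symm)]

/-- `det Jac(H) = ∏_j (∂g_j/∂x_{2j+1} + c_j·∂g_j/∂x_{2j})` — the product of the `2×2` block determinants
`det [[1, −c_j], [∂g_j/∂x_{2j}, ∂g_j/∂x_{2j+1}]]`. [cite: Villaflor2022PeriodsCI, Corollary 4 (proof)] -/
theorem det_jacobian_eq_prod [Fintype τ] [DecidableEq τ] :
    (Matrix.of fun p q : τ ⊕ τ => pderiv q (Sum.elim
        (fun j => (X (Sum.inl j) : MvPolynomial (τ ⊕ τ) K) - C (c j) * X (Sum.inr j))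
        (fermatLinearCycleFactor c d) p)).det =
      ∏ j, (pderiv (Sum.inr j) (fermatLinearCycleFactor c d j) +
        C (c j) * pderiv (Sum.inl j) (fermatLinearCycleFactor c d j)) := by
  rw [jacobian_eq_fromBlocks, Matrix.det_fromBlocks_one₁₁, Matrix.diagonal_mul_diagonal, Matrix.diagonal_sub,
    Matrix.det_diagonal]
  refine Finset.prod_congr rfl fun j _ => ?_
  ring

/-! ## The block determinant: "`d(ζ^α x^{d−1} + y^{d−1})/(x − ζ^α y)`" -/

/-- **The `2×2` block determinant.** `∂g_j/∂x_{2j+1} + c_j·∂g_j/∂x_{2j} = d·c_j·Σ_{l<d−1} x_{2j}^l (c_j x_{2j+1})^{d−2−l}`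
`= d·c_j·fermatLinearCycleFactor c (d−1) j` ("each block has determinant `d(ζ^α x_{2j−2}^{d−1} + x_{2j−1}^{d−1})/
(x_{2j−2} − ζ^α x_{2j−1})`", `ζ^{αd} = −1`). Proof: the derivation `D = ∂_{x_{2j+1}} + c_j ∂_{x_{2j}}` kills
`f_j = x_{2j} − c_j x_{2j+1}`, so `f_j·D(g_j) = D(f_j g_j) = D(x_{2j}^d − c_j^d x_{2j+1}^d) = d c_j (x_{2j}^{d−1} −
c_j^{d−1}x_{2j+1}^{d−1}) = f_j · d c_j Σ_{l<d−1}(…)`, and `f_j ≠ 0` is cancelled.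
[cite: Villaflor2022PeriodsCI, Corollary 4 (proof)] -/
theorem pderiv_inr_add_C_mul_pderiv_inl [DecidableEq τ] (hd : 1 ≤ d) (j : τ) :
    pderiv (Sum.inr j) (fermatLinearCycleFactor c d j) + C (c j) * pderiv (Sum.inl j) (fermatLinearCycleFactor c d j) =
      C ((d : K) * c j) * fermatLinearCycleFactor c (d - 1) j := by
  set u : MvPolynomial (τ ⊕ τ) K := X (Sum.inl j) - C (c j) * X (Sum.inr j) with hu
  set g : MvPolynomial (τ ⊕ τ) K := fermatLinearCycleFactor c d j with hg
  -- `D(f_j g_j) = f_j · D(g_j)` since `D(f_j) = 0`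
  have key : pderiv (Sum.inr j) (u * g) + C (c j) * pderiv (Sum.inl j) (u * g) =
      u * (pderiv (Sum.inr j) g + C (c j) * pderiv (Sum.inl j) g) := by
    rw [pderiv_mul, pderiv_mul, hu, pderiv_inl_linearForm, pderiv_inr_linearForm]
    ring
  -- `D(x^d − c^d y^d) = d c (x^{d−1} − c^{d−1} y^{d−1}) = f_j · d c · factor(d−1)`
  have hval : pderiv (Sum.inr j) (u * g) + C (c j) * pderiv (Sum.inl j) (u * g) =
      u * (C ((d : K) * c j) * fermatLinearCycleFactor c (d - 1) j) := by
    have hcd : c j ^ d = c j * c j ^ (d - 1) := by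
      rw [← pow_succ', Nat.sub_add_cancel hd]
    rw [hu, hg, linearForm_mul_fermatLinearCycleFactor, map_sub, map_sub, pderiv_C_mul, pderiv_C_mul, pderiv_pow,
      pderiv_pow, pderiv_pow, pderiv_pow, pderiv_X_self, pderiv_X_self, pderiv_X_of_ne (Sum.inl_ne_inr),
      pderiv_X_of_ne (Sum.inr_ne_inl), mul_left_comm _ (C ((d : K) * c j)), linearForm_mul_fermatLinearCycleFactor,
      hcd]
    simp only [map_mul, map_natCast]
    ring
  exact mul_left_cancel₀ (linearForm_ne_zero c j) (key.symm.trans hval)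

/-! ## Corollary 4, eq. (cycllinfer) -/

/-- **[Villaflor2022PeriodsCI] Corollary 4, eq. (cycllinfer).** The transition determinant of the presentation
`H = (f_j, g_j)_j` of the Fermat polynomial along the linear cycle `{x_{2j} = c_j x_{2j+1}}` is
`det Jac(H) = d^{n/2+1}·(∏_j c_j)·∏_j Σ_{l<d−1} x_{2j}^l (c_j x_{2j+1})^{d−2−l}`
(`= d^{n/2+1} ζ_{2d}^{α_0+α_2+⋯+α_n} ∏_j Σ_{l=0}^{d−2} x_{2j}^{d−2−l} ζ_{2d}^{α_{2j} l} x_{2j+1}^{l}` for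
`c_j = ζ_{2d}^{α_{2j}}`), for every `d ≥ 1` and every `c`. [cite: Villaflor2022PeriodsCI, Corollary 4, eq. (cycllinfer)] -/
theorem det_jacobian_eq [Fintype τ] [DecidableEq τ] (hd : 1 ≤ d) :
    (Matrix.of fun p q : τ ⊕ τ => pderiv q (Sum.elim
        (fun j => (X (Sum.inl j) : MvPolynomial (τ ⊕ τ) K) - C (c j) * X (Sum.inr j))
        (fermatLinearCycleFactor c d) p)).det =
      C ((d : K) ^ Fintype.card τ * ∏ j, c j) * fermatLinearCyclePolynomial c (d - 1) := by
  rw [det_jacobian_eq_prod, Finset.prod_congr rfl fun j _ => pderiv_inr_add_C_mul_pderiv_inl c d hd j,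
    Finset.prod_mul_distrib, fermatLinearCyclePolynomial, ← map_prod C, Finset.prod_mul_distrib, Finset.prod_const,
    Finset.card_univ]

/-! ## Consequences at the Fermat point: `det Jac(H) ∉ J^F` and `(J^F : det Jac(H)) = ⟨x_{2j} − c_j x_{2j+1}, x_i^{d−1}⟩` -/

/-- The constant `d^{n/2+1}∏_j c_j` of (cycllinfer) is non-zero when `d ≠ 0` in `K` and all `c_j ≠ 0`. [cite: Villaflor2022PeriodsCI, Corollary 4] -/
theorem constant_ne_zero [Fintype τ] (hdK : (d : K) ≠ 0) (hc : ∀ j, c j ≠ 0) :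
    (d : K) ^ Fintype.card τ * ∏ j, c j ≠ 0 :=
  mul_ne_zero (pow_ne_zero _ hdK) (Finset.prod_ne_zero_iff.mpr fun j _ => hc j)

/-- `det Jac(H) ∉ J^F = (x_i^{d−1})` (`d ≥ 2`, `d ≠ 0` in `K`, all `c_j ≠ 0`): the class `[ℙ^{n/2}]_prim` it represents
(Theorem 1) is non-zero in the Jacobian ring. [cite: Villaflor2022PeriodsCI, Theorem 1, Corollary 4] [cite: DuqueFrancoVillaflor2025Join, Remark 7.1] -/
theorem det_jacobian_not_mem [Fintype τ] [DecidableEq τ] (hd : 2 ≤ d) (hdK : (d : K) ≠ 0) (hc : ∀ j, c j ≠ 0) :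
    (Matrix.of fun p q : τ ⊕ τ => pderiv q (Sum.elim
        (fun j => (X (Sum.inl j) : MvPolynomial (τ ⊕ τ) K) - C (c j) * X (Sum.inr j))
        (fermatLinearCycleFactor c d) p)).det ∉
      Ideal.span (Set.range fun i : τ ⊕ τ => (X i : MvPolynomial (τ ⊕ τ) K) ^ (d - 1)) := by
  rw [det_jacobian_eq c d (by omega)]
  intro h
  apply fermatLinearCyclePolynomial_not_mem c (d - 1) (by omega)
  have h' := Ideal.mul_mem_left _ (C ((d : K) ^ Fintype.card τ * ∏ j, c j)⁻¹) h
  rwa [← mul_assoc, ← map_mul, inv_mul_cancel₀ (constant_ne_zero c d hdK hc), map_one, one_mul] at h'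

/-- **`(J^F : det Jac(H)) = ⟨x_{2j} − c_j x_{2j+1} (j), x_i^{d−1} (i)⟩`** — the Artinian Gorenstein ideal of the
linear cycle computed from Villaflor's transition determinant itself ([DuqueFrancoVillaflor2025Join] eq.
(eqAGfakelcFermat), tree `span_X_pow_colon_C_mul_fermatLinearCyclePolynomial`, combined with (cycllinfer)); in
particular its degree-`d` part is the Zariski tangent space of the Hodge locus `V_{[ℙ^{n/2}]}` at the Fermat point
([Villaflor2022PeriodsCI] Cor. 3: `T_tV_{[δ]} = (J^F : P_δ)_d`). Hypotheses: `d ≥ 2`, `d ≠ 0` in `K`, all `c_j ≠ 0`.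
[cite: Villaflor2022PeriodsCI, Corollary 3, Corollary 4] [cite: DuqueFrancoVillaflor2025Join, Remark 7.1, eq. (eqAGfakelcFermat)] -/
theorem span_X_pow_colon_det_jacobian [Fintype τ] [DecidableEq τ] (hd : 2 ≤ d) (hdK : (d : K) ≠ 0)
    (hc : ∀ j, c j ≠ 0) :
    (Ideal.span (Set.range fun i : τ ⊕ τ => (X i : MvPolynomial (τ ⊕ τ) K) ^ (d - 1))).colon
        {(Matrix.of fun p q : τ ⊕ τ => pderiv q (Sum.elim
          (fun j => (X (Sum.inl j) : MvPolynomial (τ ⊕ τ) K) - C (c j) * X (Sum.inr j))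
          (fermatLinearCycleFactor c d) p)).det} =
      fermatLinearCycleIdeal c (d - 1) := by
  rw [det_jacobian_eq c d (by omega),
    span_X_pow_colon_C_mul_fermatLinearCyclePolynomial c (d - 1) (by omega) (constant_ne_zero c d hdK hc)]

/-! ## Position maps: the sign of the matching (Movasati–Villaflor's `sign(b)`) -/

/-- The sign of `ρ⁻¹ ∘ e` read on the index set equals the sign of `e ∘ ρ⁻¹` read on the variables
(conjugate permutations). [folklore] -/
private theorem sign_trans_symm_eq {α β : Type*} [Fintype α] [DecidableEq α] [Fintype β] [DecidableEq β]
    (ρ e : α ≃ β) : Equiv.Perm.sign (e.trans ρ.symm) = Equiv.Perm.sign (ρ.symm.trans e) := by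
  rw [← Equiv.Perm.sign_permCongr e (e.trans ρ.symm)]
  congr 1
  ext x
  simp [Equiv.permCongr_apply]


/-- **Relabelled variables.** Put the cycle in position `ρ : τ ⊕ τ ≃ σ` (equations `rename ρ H_p`, i.e.
`x_{ρ(inl j)} − c_j x_{ρ(inr j)}` and its cofactor, in the polynomial ring on `σ`) and match equations with variables
through ANY bijection `e : τ ⊕ τ ≃ σ`. Then `det (∂(rename ρ H_p)/∂x_{e(q)})_{p,q} = sign(ρ⁻¹ ∘ e) · rename ρ (det Jac(H))`
`= sign(e ∘ ρ⁻¹) · d^{n/2+1}(∏ c_j) · P_{c,ρ}` (`e ∘ ρ⁻¹ = ρ.symm.trans e`, a permutation of the variables `σ`; the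
conjugate permutation `ρ⁻¹ ∘ e` of the index set has the same sign) — the orientation sign `sign(b)` of the pairing
in [MovasatiVillaflor2018] Thm. 1. [cite: MovasatiVillaflor2018, Theorem 1] [cite: Villaflor2022PeriodsCI, Corollary 4, Corollary 5] -/
theorem det_jacobian_rename [Fintype τ] [DecidableEq τ] {σ : Type*} [Fintype σ] [DecidableEq σ]
    (ρ e : τ ⊕ τ ≃ σ) (hd : 1 ≤ d) :
    (Matrix.of fun p q : τ ⊕ τ => pderiv (e q) (rename ρ (Sum.elim
        (fun j => (X (Sum.inl j) : MvPolynomial (τ ⊕ τ) K) - C (c j) * X (Sum.inr j))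
        (fermatLinearCycleFactor c d) p))).det =
      ((Equiv.Perm.sign (ρ.symm.trans e) : ℤ) : MvPolynomial σ K) *
        rename ρ (C ((d : K) ^ Fintype.card τ * ∏ j, c j) * fermatLinearCyclePolynomial c (d - 1)) := by
  set H : τ ⊕ τ → MvPolynomial (τ ⊕ τ) K := Sum.elim
    (fun j => (X (Sum.inl j) : MvPolynomial (τ ⊕ τ) K) - C (c j) * X (Sum.inr j)) (fermatLinearCycleFactor c d)
    with hH
  have hmat : (Matrix.of fun p q : τ ⊕ τ => pderiv (e q) (rename ρ (H p))) =
      (rename ρ).toRingHom.mapMatrix ((Matrix.of fun p q : τ ⊕ τ => pderiv q (H p)).submatrix id (e.trans ρ.symm)) := by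
    refine Matrix.ext fun p q => ?_
    rw [Matrix.of_apply, RingHom.mapMatrix_apply, Matrix.map_apply, Matrix.submatrix_apply, Matrix.of_apply, id,
      Equiv.trans_apply, AlgHom.toRingHom_eq_coe, RingHom.coe_coe]
    conv_lhs => rw [← ρ.apply_symm_apply (e q)]
    exact pderiv_rename (R := K) ρ.injective (ρ.symm (e q)) (H p)
  rw [hmat, ← RingHom.map_det, Matrix.det_permute', map_mul, AlgHom.toRingHom_eq_coe, RingHom.coe_coe, hH,
    det_jacobian_eq c d hd, map_intCast, sign_trans_symm_eq ρ e]

/-- In NATURAL position (equations matched with variables through the position map itself, `e = ρ`) the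
transition determinant is just the relabelled one: `rename ρ (d^{n/2+1}(∏ c_j)·P_c)`.
[cite: Villaflor2022PeriodsCI, Corollary 4] [cite: MovasatiVillaflor2018, Theorem 1] -/
theorem det_jacobian_rename_self [Fintype τ] [DecidableEq τ] {σ : Type*} [Fintype σ] [DecidableEq σ]
    (ρ : τ ⊕ τ ≃ σ) (hd : 1 ≤ d) :
    (Matrix.of fun p q : τ ⊕ τ => pderiv (ρ q) (rename ρ (Sum.elim
        (fun j => (X (Sum.inl j) : MvPolynomial (τ ⊕ τ) K) - C (c j) * X (Sum.inr j))
        (fermatLinearCycleFactor c d) p))).det =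
      rename ρ (C ((d : K) ^ Fintype.card τ * ∏ j, c j) * fermatLinearCyclePolynomial c (d - 1)) := by
  rw [det_jacobian_rename c d ρ ρ hd, Equiv.symm_trans_self, Equiv.Perm.sign_refl, Units.val_one, Int.cast_one,
    one_mul]

end Literature.AlgebraicGeometry.Villaflor2022
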